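import Mathlib
import Literature.AlgebraicGeometry.Resolution.TeissierPresentation
import Literature.AlgebraicGeometry.Resolution.CompleteFiniteness
import Literature.AlgebraicGeometry.Resolution.PowerSeriesRegularLocal
import Summits.ResolutionOfSingularities.ResolutionOfSingularities.Theorems.TeissierJungTeissierResolveBranchFiniteLemmas
import HarnessLib

/-!
# `TeissierResolve`, line `Sketch`: Teissier branches are module-finite over `k⟦x₁, …, x_d⟧`

Route `ResolutionOfSingularities/TeissierJung`, crux `TeissierResolve`
(stmt-ResolutionOfSingularities-17086), stub `stub_branchFinite` of the lead's skeleton, PROVED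
here (statement verbatim from the ledger registration).

**Statement.** Let `π : X' → S` be a finite morphism of locally Noetherian schemes, `x ∈ X'`,
`P` an ideal of the completed local ring `𝒪̂_{X',x}`, `φ : 𝒪̂_{S,π x} ≅ k⟦x₁, …, x_d⟧` a ring
isomorphism (`k` algebraically closed) and `ι : k⟦x⟧ → B := 𝒪̂_{X',x} ⧸ P` a ring homomorphism
carrying a Teissier presentation of `B` and agreeing with the stalk map of `π` on `𝒪_{S,π x}`.
Then `B` is a finite `k⟦x⟧`-module through `ι`.

**Proof.** The tree's assembled Matsumura Thm. 8.4
(`module_finite_of_isAdicComplete_of_residue_surjective`, `CompleteFiniteness.lean`) applied to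
`k⟦x⟧ → B`: `k⟦x⟧` is a complete local ring; `B` is a Noetherian local ring (`B ≅ k⟦x⟧[u]/I`
is Noetherian and nonzero, and a nonzero quotient of the local ring `𝒪̂_{X',x}`), hence separated;
`ι((x)) B` is a proper ideal and `k⟦x⟧ → B/𝔪_B` is onto (the lemmas file
`TeissierJungTeissierResolveBranchFiniteLemmas.lean`: the equations and the `x_j` have a common
zero over `k`, and the residue field is `k` by the Nullstellensatz); finally `𝔪_B^N ⊆ ι((x)) B`:
`π` is finite, hence quasi-finite at `x`, so the fibre ring `𝒪_{X',x}/𝔪_S 𝒪_{X',x}` is Artinian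
local and `𝔪_x^N ⊆ 𝔪_S 𝒪_{X',x}` (`exists_pow_maximalIdeal_le_of_quasiFinite`); push this through
`𝒪_{X',x} → 𝒪̂_{X',x} → B` (the maximal ideal of the completion of a Noetherian local ring is the
extended one) and use `hι` together with the locality of `𝒪_{S,πx} → 𝒪̂_{S,πx} ≅ k⟦x⟧` to land
in `ι((x)) B`.

Sources: H. Matsumura, *Commutative Ring Theory*, CUP 1986, Thm. 8.4 and proof of Thm. 29.4 (iii);
The Stacks Project, Tags 00PL/02NG (quasi-finiteness of finite morphisms). Everything here is
[folklore]; no definitions, no named facts.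
-/

noncomputable section

set_option linter.dupNamespace false -- mandated namespace of this single-conjunct summit

open CategoryTheory AlgebraicGeometry TopologicalSpace IsLocalRing
open Literature.AlgebraicGeometry.Resolution
open Summit.ResolutionOfSingularities.ResolutionOfSingularities.Theorems.TeissierResolve.BranchFiniteLemmas

namespace Summit.ResolutionOfSingularities.ResolutionOfSingularities.Theorems.TeissierResolve.BranchFinite

universe u v

/-- **The fibre of a quasi-finite local homomorphism is infinitesimal**: if
`f : (R, 𝔪_R) → (S, 𝔪_S)` is a quasi-finite local homomorphism of local rings, then
`𝔪_S^N ⊆ 𝔪_R S` for some `N` — the fibre ring `S/𝔪_R S ≅ κ(𝔪_R) ⊗_R S` is an Artinian local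
ring, whose maximal ideal is nilpotent. [folklore] -/
theorem exists_pow_maximalIdeal_le_of_quasiFinite {R : Type u} {S : Type v} [CommRing R]
    [CommRing S] [IsLocalRing R] [IsLocalRing S] (f : R →+* S) [IsLocalHom f]
    (hf : f.QuasiFinite) : ∃ N, maximalIdeal S ^ N ≤ (maximalIdeal R).map f := by
  letI := f.toAlgebra
  haveI : Algebra.QuasiFinite R S := hf
  set J : Ideal S := (maximalIdeal R).map f with hJ
  have hJ' : J = (maximalIdeal R).map (algebraMap R S) := rfl
  -- the fibre ring `κ(𝔪_R) ⊗ S ≅ S/𝔪_R S` is Artinian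
  have e : (maximalIdeal R).Fiber S ≃+* S ⧸ J :=
    ((Algebra.TensorProduct.congr
        (AlgEquiv.ofBijective
          (IsScalarTower.toAlgHom R (R ⧸ maximalIdeal R) (maximalIdeal R).ResidueField)
          (Ideal.bijective_algebraMap_quotient_residueField (maximalIdeal R))).symm
        (AlgEquiv.refl : S ≃ₐ[R] S)).toRingEquiv.trans
      (Algebra.TensorProduct.quotIdealMapEquivQuotTensor S (maximalIdeal R)).symm.toRingEquiv).trans
      (Ideal.quotEquivOfEq hJ'.symm)
  haveI : IsArtinianRing (S ⧸ J) := e.isArtinianRing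
  have hJle : J ≤ maximalIdeal S := map_maximalIdeal_le f
  haveI : Nontrivial (S ⧸ J) :=
    Ideal.Quotient.nontrivial_iff.mpr (ne_top_of_le_ne_top (maximalIdeal.isMaximal S).ne_top hJle)
  haveI : IsLocalRing (S ⧸ J) :=
    IsLocalRing.of_surjective' (Ideal.Quotient.mk J) Ideal.Quotient.mk_surjective
  obtain ⟨N, hN⟩ := (isArtinianRing_iff_isNilpotent_maximalIdeal (S ⧸ J)).mp inferInstance
  refine ⟨N, fun s hs => ?_⟩
  have hmap : maximalIdeal (S ⧸ J) = (maximalIdeal S).map (Ideal.Quotient.mk J) :=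
    (IsLocalRing.map_maximalIdeal_of_surjective _ Ideal.Quotient.mk_surjective).symm
  have hmem : Ideal.Quotient.mk J s ∈ maximalIdeal (S ⧸ J) ^ N := by
    rw [hmap, ← Ideal.map_pow]
    exact Ideal.mem_map_of_mem _ hs
  rw [hN, Ideal.zero_eq_bot, Ideal.mem_bot, Ideal.Quotient.eq_zero_iff_mem] at hmem
  exact hmem

/-- Pushing `𝔪_O^N ⊆ J` through `O → Ô → Ô/P` for a Noetherian local ring `O`: the maximal ideal
of a local quotient `Ô/P` of the completion is the extension of `𝔪_O`
(`AdicCompletion.maximalIdeal_eq_map`), so `𝔪_{Ô/P}^N ⊆ J·(Ô/P)`. [folklore] -/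
theorem pow_maximalIdeal_quotient_le_map {O : Type u} [CommRing O] [IsLocalRing O]
    [IsNoetherianRing O] {J : Ideal O} {N : ℕ} (hN : maximalIdeal O ^ N ≤ J)
    (P : Ideal (AdicCompletion (maximalIdeal O) O))
    [IsLocalRing (AdicCompletion (maximalIdeal O) O ⧸ P)] :
    maximalIdeal (AdicCompletion (maximalIdeal O) O ⧸ P) ^ N ≤
      J.map ((Ideal.Quotient.mk P).comp (algebraMap O (AdicCompletion (maximalIdeal O) O))) := by
  rw [← IsLocalRing.map_maximalIdeal_of_surjective (Ideal.Quotient.mk P)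
      Ideal.Quotient.mk_surjective, AdicCompletion.maximalIdeal_eq_map, ← Ideal.map_pow,
    ← Ideal.map_pow, ← Ideal.map_map]
  exact Ideal.map_mono (Ideal.map_mono hN)

/-- **Finiteness of Teissier branches.** In the situation of `TF` at a point `x` (a finite
`π : X' → S` of locally Noetherian schemes, an ideal `P` of `𝒪̂_{X',x}`, a ring isomorphism
`φ : 𝒪̂_{S,π x} ≅ k⟦x₁..x_d⟧` and a structure map `ι : k⟦x⟧ → 𝒪̂_{X',x} ⧸ P` carrying a Teissier
presentation and agreeing with the stalk map of `π` on `𝒪_{S,π x}`), the branch `𝒪̂_{X',x} ⧸ P`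
is MODULE-FINITE over `k⟦x⟧` through `ι`: `ι((x)) · B ⊇ 𝔪_S B ⊇ 𝔪_B^N` (the fibre of `π` is
finite), `ι((x)) B` is a proper ideal, `B` is a complete Noetherian local ring whose residue field
is `k`, so Matsumura's Thm. 8.4 (`module_finite_of_isAdicComplete_of_residue_surjective`) applies.
[folklore] -/
theorem stub_branchFinite {k : Type} [Field k] [IsAlgClosed k] {X' S : Scheme.{0}}
    [IsLocallyNoetherian X'] [IsLocallyNoetherian S] (π : X' ⟶ S) [IsFinite π] (x : X')
    (P : Ideal (AdicCompletion (maximalIdeal (X'.presheaf.stalk x)) (X'.presheaf.stalk x)))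
    (d : ℕ)
    (φ : AdicCompletion (maximalIdeal (S.presheaf.stalk (π.base x))) (S.presheaf.stalk (π.base x))
      ≃+* MvPowerSeries (Fin d) k)
    (ι : MvPowerSeries (Fin d) k →+*
      AdicCompletion (maximalIdeal (X'.presheaf.stalk x)) (X'.presheaf.stalk x) ⧸ P)
    (hpres : TeissierPresentation k d _ ι)
    (hι : ∀ a : S.presheaf.stalk (π.base x),
      ι (φ (algebraMap _ _ a)) = Ideal.Quotient.mk P (algebraMap _ _ ((π.stalkMap x).hom a))) :
    letI := ι.toAlgebra
    Module.Finite (MvPowerSeries (Fin d) k)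
      (AdicCompletion (maximalIdeal (X'.presheaf.stalk x)) (X'.presheaf.stalk x) ⧸ P) := by
  letI := ι.toAlgebra
  -- `B = 𝒪̂_{X',x} ⧸ P` is a nonzero Noetherian local ring
  haveI : Nontrivial
      (AdicCompletion (maximalIdeal (X'.presheaf.stalk x)) (X'.presheaf.stalk x) ⧸ P) :=
    TeissierPresentation.nontrivial hpres
  haveI : IsLocalRing
      (AdicCompletion (maximalIdeal (X'.presheaf.stalk x)) (X'.presheaf.stalk x) ⧸ P) :=
    IsLocalRing.of_surjective' (Ideal.Quotient.mk P) Ideal.Quotient.mk_surjective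
  haveI : IsNoetherianRing
      (AdicCompletion (maximalIdeal (X'.presheaf.stalk x)) (X'.presheaf.stalk x) ⧸ P) :=
    TeissierPresentation.isNoetherianRing hpres
  -- `k⟦x⟧` is complete for its maximal ideal `(x₁, …, x_d)`
  haveI : IsAdicComplete (maximalIdeal (MvPowerSeries (Fin d) k)) (MvPowerSeries (Fin d) k) := by
    rw [maximalIdeal_mvPowerSeries_eq_span k (Fin d)]
    infer_instance
  -- `ι((x)) B` is proper
  have hloc : (maximalIdeal (MvPowerSeries (Fin d) k)).map ι ≤ maximalIdeal _ :=
    IsLocalRing.le_maximalIdeal (TeissierPresentation.map_maximalIdeal_ne_top hpres)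
  -- the fibre of `π` at `x` is infinitesimal: `𝔪_x^N ⊆ 𝔪_S 𝒪_{X',x}`
  obtain ⟨N, hN⟩ :=
    exists_pow_maximalIdeal_le_of_quasiFinite (π.stalkMap x).hom (π.quasiFiniteAt x)
  have hfib := pow_maximalIdeal_quotient_le_map hN P
  -- `𝔪_S B ⊆ ι((x)) B`, by `hι` and the locality of `𝒪_{S,πx} → 𝒪̂_{S,πx} ≅ k⟦x⟧`
  have hcmp : ((maximalIdeal (S.presheaf.stalk (π.base x))).map (π.stalkMap x).hom).map
      ((Ideal.Quotient.mk P).comp (algebraMap (X'.presheaf.stalk x)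
        (AdicCompletion (maximalIdeal (X'.presheaf.stalk x)) (X'.presheaf.stalk x)))) ≤
      (maximalIdeal (MvPowerSeries (Fin d) k)).map ι := by
    rw [Ideal.map_map, Ideal.map_le_iff_le_comap]
    intro a ha
    rw [Ideal.mem_comap, RingHom.comp_apply, RingHom.comp_apply, ← hι a]
    refine Ideal.mem_map_of_mem ι ?_
    have h1 : algebraMap _ (AdicCompletion (maximalIdeal (S.presheaf.stalk (π.base x)))
        (S.presheaf.stalk (π.base x))) a ∈ maximalIdeal _ := map_nonunit _ a ha
    rw [IsLocalRing.mem_maximalIdeal, mem_nonunits_iff] at h1 ⊢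
    exact fun hu => h1 ((isUnit_map_iff φ _).mp hu)
  exact module_finite_of_isAdicComplete_of_residue_surjective hloc
    (TeissierPresentation.residue_comp_surjective hpres) ⟨N, hfib.trans hcmp⟩

end Summit.ResolutionOfSingularities.ResolutionOfSingularities.Theorems.TeissierResolve.BranchFinite

end
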